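import Summits.Ventures.PercRepro.StarGadgetFS0
import Summits.Ventures.PercRepro.StarGadgetFSpos

/-!
# F ≥ 0 on ℕ⁴: the half-space lemmas and the finite uncovered boxes

The uncovered points (p, q, r ≤ 3 at s = 0; p ≤ 1, q = r = 0, s = 1) are evaluated by `interval_cases` + `norm_num`.
-/

namespace PercRepro.StarGadget

/-- **`F ≥ 0` on `ℕ⁴`**: the (★)-slack of every star gadget with the edge `cx` is nonnegative. -/
theorem F_nonneg (p q r s : ℕ) : 0 ≤ F p q r s := by
  rcases s with _ | s
  · by_cases hp : 4 ≤ p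
    · obtain ⟨p, rfl⟩ := Nat.exists_eq_add_of_le' hp
      exact F_s0_p_000 p q r
    by_cases hq : 4 ≤ q
    · obtain ⟨q, rfl⟩ := Nat.exists_eq_add_of_le' hq
      exact F_s0_q_000 p q r
    by_cases hr : 4 ≤ r
    · obtain ⟨r, rfl⟩ := Nat.exists_eq_add_of_le' hr
      exact F_s0_r_000 p q r
    push Not at hp hq hr
    interval_cases p <;> interval_cases q <;> interval_cases r <;> norm_num [F]
  · by_cases hp : 2 ≤ p
    · obtain ⟨p, rfl⟩ := Nat.exists_eq_add_of_le' hp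
      exact F_spos_p_0001 p q r s
    by_cases hq : 1 ≤ q
    · obtain ⟨q, rfl⟩ := Nat.exists_eq_add_of_le' hq
      exact F_spos_q_0001 p q r s
    by_cases hr : 1 ≤ r
    · obtain ⟨r, rfl⟩ := Nat.exists_eq_add_of_le' hr
      exact F_spos_r_0001 p q r s
    by_cases hs : 1 ≤ s
    · obtain ⟨s, rfl⟩ := Nat.exists_eq_add_of_le' hs
      exact F_spos_s_0001 p q r s
    push Not at hp hq hr hs
    interval_cases p <;> interval_cases q <;> interval_cases r <;> interval_cases s <;> norm_num [F]

end PercRepro.StarGadget
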